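import Mathlib.Analysis.Calculus.BumpFunction.InnerProduct
import Mathlib.Analysis.Calculus.ContDiff.Operations
import Mathlib.Topology.Algebra.InfiniteSum.Basic
import HarnessLib

/-!
# Route SelfMixingDichotomy — crux `SequentialTypeIExclusion` (S1, stmt-NavierStokesRegularity-1424), line `registered`,
# lead c6 (pulsating kinematic witness package): stub W1 `pulse_amplitude_exists`

Support file (`--supports stmt-NavierStokesRegularity-1424`). It lands the registered stub
`pulse_amplitude_exists` of the sub-skeleton `PulsatingWitness` (lead c6): the time-dependent AMPLITUDE of the
pulsating kinematic witness, a pulse train accumulating at the blow-up time `t = 1`.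

With `sₘ = (2^{4m²})⁻¹` we need `a : ℝ → ℝ`, smooth on `(−∞, 1)`, nonnegative, `a 0 = 0`, `a = 2ⁿ` on the
`n`-th plateau `1 − t ∈ [sₙ/5, sₙ/4]`, and wherever `a t ≠ 0` some pulse `1 − t ∈ (sₘ/6, sₘ/3)` with `a t ≤ 2ᵐ`.

Construction: ONE normalised bump `φ : ContDiffBump (9/40)` with radii `1/40 < 1/20` (so `φ = 1` on
`[1/5, 1/4]`, `supp φ = (7/40, 11/40)`, `0 ≤ φ ≤ 1`), rescaled to every pulse,
`a t = ∑' m, 2ᵐ · φ ((1 − t) · 2^{4m²})`. Since consecutive scales differ by a factor `≥ 16 > 11/7`, the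
rescaled bumps have pairwise disjoint supports, so the series has at most one nonzero term at each `t`
(`tsum_eq_single`), and below time `1 − s_N` only the first `N` bumps are present (`tsum_eq_sum`), which gives
smoothness on `(−∞, 1)` locally (`contDiffOn_of_locally_contDiffOn`).
-/

noncomputable section

open Set Metric

open scoped ContDiff

set_option linter.dupNamespace false

namespace Summit.NavierStokesRegularity.NavierStokesRegularity.Theorems.SequentialTypeIExclusion.Registered

/-- Scale separation of the pulse train: for `m < m'`, `16 · 2^{4m²} ≤ 2^{4m'²}`. -/
theorem pulse_amplitude_exists_scale_sep {m m' : ℕ} (h : m < m') :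
    16 * (2 : ℝ) ^ (4 * m ^ 2) ≤ (2 : ℝ) ^ (4 * m' ^ 2) := by
  have h1 : 4 * m ^ 2 + 4 ≤ 4 * m' ^ 2 := by
    have : m + 1 ≤ m' := h
    nlinarith
  calc 16 * (2 : ℝ) ^ (4 * m ^ 2) = (2 : ℝ) ^ (4 * m ^ 2 + 4) := by rw [pow_add]; norm_num; ring
    _ ≤ (2 : ℝ) ^ (4 * m' ^ 2) := pow_le_pow_right₀ (by norm_num) h1

/-- Scales are monotone: for `N ≤ m`, `2^{4N²} ≤ 2^{4m²}`. -/
theorem pulse_amplitude_exists_scale_mono {N m : ℕ} (h : N ≤ m) :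
    (2 : ℝ) ^ (4 * N ^ 2) ≤ (2 : ℝ) ^ (4 * m ^ 2) :=
  pow_le_pow_right₀ (by norm_num) (Nat.mul_le_mul_left 4 (Nat.pow_le_pow_left h 2))

/-- The normalised bump is supported in `(7/40, 11/40)`. -/
theorem pulse_amplitude_exists_bump_support (φ : ContDiffBump ((9 : ℝ) / 40)) (hOut : φ.rOut = 1 / 20)
    {x : ℝ} (hx : φ x ≠ 0) : 7 / 40 < x ∧ x < 11 / 40 := by
  have hx' : x ∈ Function.support (φ : ℝ → ℝ) := hx
  rw [φ.support_eq, hOut, Real.ball_eq_Ioo] at hx'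
  constructor
  · linarith [hx'.1]
  · linarith [hx'.2]

/-- The normalised bump equals `1` on `[1/5, 1/4]`. -/
theorem pulse_amplitude_exists_bump_one (φ : ContDiffBump ((9 : ℝ) / 40)) (hIn : φ.rIn = 1 / 40)
    {x : ℝ} (h1 : 1 / 5 ≤ x) (h2 : x ≤ 1 / 4) : φ x = 1 := by
  apply φ.one_of_mem_closedBall
  rw [hIn, Real.closedBall_eq_Icc]
  constructor
  · linarith
  · linarith

/-- Disjointness of the rescaled bumps (ordered version). -/
theorem pulse_amplitude_exists_disjoint_lt (φ : ContDiffBump ((9 : ℝ) / 40)) (hOut : φ.rOut = 1 / 20)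
    {u : ℝ} {m m' : ℕ} (hmm' : m < m') (hm : φ (u * (2 : ℝ) ^ (4 * m ^ 2)) ≠ 0)
    (hm' : φ (u * (2 : ℝ) ^ (4 * m' ^ 2)) ≠ 0) : False := by
  obtain ⟨h1, -⟩ := pulse_amplitude_exists_bump_support φ hOut hm
  obtain ⟨-, h2⟩ := pulse_amplitude_exists_bump_support φ hOut hm'
  have hsep := pulse_amplitude_exists_scale_sep hmm'
  have hP : (0 : ℝ) < (2 : ℝ) ^ (4 * m ^ 2) := by positivity
  have hu : 0 < u := by
    by_contra hu
    push Not at hu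
    have : u * (2 : ℝ) ^ (4 * m ^ 2) ≤ 0 := mul_nonpos_of_nonpos_of_nonneg hu hP.le
    linarith
  have h3 : u * (16 * (2 : ℝ) ^ (4 * m ^ 2)) ≤ u * (2 : ℝ) ^ (4 * m' ^ 2) :=
    mul_le_mul_of_nonneg_left hsep hu.le
  nlinarith

/-- Disjointness of the rescaled bumps: at each time at most one of them is nonzero. -/
theorem pulse_amplitude_exists_disjoint (φ : ContDiffBump ((9 : ℝ) / 40)) (hOut : φ.rOut = 1 / 20)
    {u : ℝ} {m m' : ℕ} (hm : φ (u * (2 : ℝ) ^ (4 * m ^ 2)) ≠ 0)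
    (hm' : φ (u * (2 : ℝ) ^ (4 * m' ^ 2)) ≠ 0) : m = m' := by
  by_contra hne
  rcases Nat.lt_or_gt_of_ne hne with h | h
  · exact pulse_amplitude_exists_disjoint_lt φ hOut h hm hm'
  · exact pulse_amplitude_exists_disjoint_lt φ hOut h hm' hm

/-- Pointwise evaluation of the pulse series: either every term vanishes (and the sum is `0`), or exactly one
bump `m₀` is active and the sum is `2^{m₀} φ(…)`. -/
theorem pulse_amplitude_exists_tsum (φ : ContDiffBump ((9 : ℝ) / 40)) (hOut : φ.rOut = 1 / 20) (u : ℝ) :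
    ((∑' m : ℕ, (2 : ℝ) ^ m * φ (u * (2 : ℝ) ^ (4 * m ^ 2))) = 0 ∧
        ∀ m : ℕ, φ (u * (2 : ℝ) ^ (4 * m ^ 2)) = 0) ∨
      ∃ m₀ : ℕ, φ (u * (2 : ℝ) ^ (4 * m₀ ^ 2)) ≠ 0 ∧
        (∑' m : ℕ, (2 : ℝ) ^ m * φ (u * (2 : ℝ) ^ (4 * m ^ 2))) =
          (2 : ℝ) ^ m₀ * φ (u * (2 : ℝ) ^ (4 * m₀ ^ 2)) := by
  by_cases h : ∃ m₀ : ℕ, φ (u * (2 : ℝ) ^ (4 * m₀ ^ 2)) ≠ 0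
  · obtain ⟨m₀, hm₀⟩ := h
    refine Or.inr ⟨m₀, hm₀, tsum_eq_single m₀ (fun m hm => ?_)⟩
    have : φ (u * (2 : ℝ) ^ (4 * m ^ 2)) = 0 := by
      by_contra hmz
      exact hm (pulse_amplitude_exists_disjoint φ hOut hmz hm₀)
    rw [this, mul_zero]
  · push Not at h
    refine Or.inl ⟨?_, h⟩
    simp only [h, mul_zero, tsum_zero]

/-- Local finiteness: if `1 < u · 2^{4N²}` then all bumps of index `m ≥ N` vanish at `u`. -/
theorem pulse_amplitude_exists_vanish (φ : ContDiffBump ((9 : ℝ) / 40)) (hOut : φ.rOut = 1 / 20)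
    {u : ℝ} {N m : ℕ} (hN : 1 < u * (2 : ℝ) ^ (4 * N ^ 2)) (hNm : N ≤ m) :
    φ (u * (2 : ℝ) ^ (4 * m ^ 2)) = 0 := by
  by_contra hne
  obtain ⟨h1, h2⟩ := pulse_amplitude_exists_bump_support φ hOut hne
  have hP : (0 : ℝ) < (2 : ℝ) ^ (4 * m ^ 2) := by positivity
  have hu : 0 < u := by
    by_contra hu
    push Not at hu
    have : u * (2 : ℝ) ^ (4 * m ^ 2) ≤ 0 := mul_nonpos_of_nonpos_of_nonneg hu hP.le
    linarith
  have h3 : u * (2 : ℝ) ^ (4 * N ^ 2) ≤ u * (2 : ℝ) ^ (4 * m ^ 2) :=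
    mul_le_mul_of_nonneg_left (pulse_amplitude_exists_scale_mono hNm) hu.le
  linarith

/-- **W1 — the pulsating amplitude.** A function `a : ℝ → ℝ`, smooth on `(−∞, 1)`, nonnegative, vanishing at
`t = 0`, equal to `2ⁿ` on the `n`-th plateau `1 − t ∈ [sₙ/5, sₙ/4]` and supported, away from its zeros, in the
pulses `1 − t ∈ (sₘ/6, sₘ/3)` with `a ≤ 2ᵐ` there (`sₙ = (2^{4n²})⁻¹`). Construction: a locally finite sum of
rescaled copies of one `ContDiffBump` centred at `9/40` with radii `1/40 < 1/20`. -/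
theorem pulse_amplitude_exists :
    ∃ a : ℝ → ℝ, ContDiffOn ℝ (⊤ : ℕ∞) a (Set.Iio 1) ∧ (∀ t : ℝ, 0 ≤ a t) ∧ a 0 = 0 ∧
      (∀ (n : ℕ) (t : ℝ), 1 - t ∈ Set.Icc (((2 : ℝ) ^ (4 * n ^ 2))⁻¹ / 5) (((2 : ℝ) ^ (4 * n ^ 2))⁻¹ / 4) →
        a t = 2 ^ n) ∧
      (∀ t : ℝ, a t = 0 ∨ ∃ m : ℕ,
        1 - t ∈ Set.Ioo (((2 : ℝ) ^ (4 * m ^ 2))⁻¹ / 6) (((2 : ℝ) ^ (4 * m ^ 2))⁻¹ / 3) ∧ a t ≤ 2 ^ m) := by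
  obtain ⟨φ, hIn, hOut⟩ : ∃ φ : ContDiffBump ((9 : ℝ) / 40), φ.rIn = 1 / 40 ∧ φ.rOut = 1 / 20 :=
    ⟨⟨1 / 40, 1 / 20, by norm_num, by norm_num⟩, rfl, rfl⟩
  refine ⟨fun t => ∑' m : ℕ, (2 : ℝ) ^ m * φ ((1 - t) * (2 : ℝ) ^ (4 * m ^ 2)), ?_, ?_, ?_, ?_, ?_⟩
  · -- smoothness on `(−∞, 1)`: locally a finite sum of smooth functions
    refine contDiffOn_of_locally_contDiffOn (fun t₀ ht₀ => ?_)
    have hpos : 0 < 1 - t₀ := by simpa using ht₀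
    obtain ⟨N, hN⟩ := exists_nat_gt (1 - t₀)⁻¹
    have hPN : (0 : ℝ) < (2 : ℝ) ^ (4 * N ^ 2) := by positivity
    have hsmall : ((2 : ℝ) ^ (4 * N ^ 2))⁻¹ < 1 - t₀ := by
      rw [inv_lt_comm₀ hPN hpos]
      have h1 : (N : ℝ) < (2 : ℝ) ^ N := by exact_mod_cast Nat.lt_two_pow_self
      have h2 : (2 : ℝ) ^ N ≤ (2 : ℝ) ^ (4 * N ^ 2) := pow_le_pow_right₀ (by norm_num) (by nlinarith)
      linarith
    refine ⟨Set.Iio (1 - ((2 : ℝ) ^ (4 * N ^ 2))⁻¹), isOpen_Iio,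
      by simp only [Set.mem_Iio]; linarith, ?_⟩
    have hfin : ContDiff ℝ (⊤ : ℕ∞)
        (fun t : ℝ => ∑ m ∈ Finset.range N, (2 : ℝ) ^ m * φ ((1 - t) * (2 : ℝ) ^ (4 * m ^ 2))) := by
      refine ContDiff.sum (fun m _ => contDiff_const.mul ?_)
      exact φ.contDiff.comp ((contDiff_const.sub contDiff_id).mul contDiff_const)
    refine hfin.contDiffOn.congr (fun t ht => ?_)
    have ht' : ((2 : ℝ) ^ (4 * N ^ 2))⁻¹ < 1 - t := by
      have := ht.2
      simp only [Set.mem_Iio] at this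
      linarith
    have hone : 1 < (1 - t) * (2 : ℝ) ^ (4 * N ^ 2) := by
      have := mul_lt_mul_of_pos_right ht' hPN
      rwa [inv_mul_cancel₀ hPN.ne'] at this
    refine tsum_eq_sum (fun m hm => ?_)
    have hNm : N ≤ m := by simpa using hm
    rw [pulse_amplitude_exists_vanish φ hOut hone hNm, mul_zero]
  · -- nonnegativity
    intro t
    rcases pulse_amplitude_exists_tsum φ hOut (1 - t) with ⟨h0, -⟩ | ⟨m₀, -, hm₀⟩
    · simp only [h0, le_refl]
    · simp only [hm₀]
      exact mul_nonneg (by positivity) φ.nonneg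
  · -- `a 0 = 0`: no pulse contains `1 - 0 = 1`
    rcases pulse_amplitude_exists_tsum φ hOut (1 - 0) with ⟨h0, -⟩ | ⟨m₀, hne, -⟩
    · simpa using h0
    · exfalso
      obtain ⟨-, h2⟩ := pulse_amplitude_exists_bump_support φ hOut hne
      have : (1 : ℝ) ≤ (2 : ℝ) ^ (4 * m₀ ^ 2) := one_le_pow₀ (by norm_num)
      linarith
  · -- plateaux
    intro n t ht
    have hP : (0 : ℝ) < (2 : ℝ) ^ (4 * n ^ 2) := by positivity
    have h1 : 1 / 5 ≤ (1 - t) * (2 : ℝ) ^ (4 * n ^ 2) := by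
      rw [← div_le_iff₀ hP]
      have := ht.1
      rwa [inv_eq_one_div, div_div, mul_comm, ← div_div] at this
    have h2 : (1 - t) * (2 : ℝ) ^ (4 * n ^ 2) ≤ 1 / 4 := by
      rw [← le_div_iff₀ hP]
      have := ht.2
      rwa [inv_eq_one_div, div_div, mul_comm, ← div_div] at this
    have hone := pulse_amplitude_exists_bump_one φ hIn h1 h2
    rcases pulse_amplitude_exists_tsum φ hOut (1 - t) with ⟨-, h0⟩ | ⟨m₀, hne, hm₀⟩
    · exfalso
      have := h0 n
      rw [hone] at this
      exact one_ne_zero this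
    · have hmn : m₀ = n :=
        pulse_amplitude_exists_disjoint φ hOut hne (by rw [hone]; exact one_ne_zero)
      subst hmn
      simp only [hm₀, hone, mul_one]
  · -- support clause
    intro t
    rcases pulse_amplitude_exists_tsum φ hOut (1 - t) with ⟨h0, -⟩ | ⟨m₀, hne, hm₀⟩
    · exact Or.inl h0
    · refine Or.inr ⟨m₀, ?_, ?_⟩
      · have hP : (0 : ℝ) < (2 : ℝ) ^ (4 * m₀ ^ 2) := by positivity
        obtain ⟨h1, h2⟩ := pulse_amplitude_exists_bump_support φ hOut hne
        constructor
        · have h3 : 1 / 6 < (1 - t) * (2 : ℝ) ^ (4 * m₀ ^ 2) := by linarith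
          rw [← div_lt_iff₀ hP] at h3
          rwa [inv_eq_one_div, div_div, mul_comm, ← div_div]
        · have h3 : (1 - t) * (2 : ℝ) ^ (4 * m₀ ^ 2) < 1 / 3 := by linarith
          rw [← lt_div_iff₀ hP] at h3
          rwa [inv_eq_one_div, div_div, mul_comm, ← div_div]
      · simp only [hm₀]
        exact mul_le_of_le_one_right (by positivity) φ.le_one

end Summit.NavierStokesRegularity.NavierStokesRegularity.Theorems.SequentialTypeIExclusion.Registered

end
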